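import Mathlib

/-!
# The big block is not a lower-set statement: a kernel-checked negative (blind cell PercRepro2,
night-4 g17, 2026-08-27; proofs/NIGHT4-G17.md §4′)

The surviving candidate for the mixed-arm case of the single junction is the BIG BLOCK
`B′ = F ∪ orbit(φ) ∪ orbit(φ^Z)` (NIGHT4-G17.md §3).  In the raw colour classes around the mixed
one-sided point `φ` — `s` = the u-arm red, `a` = the h-piece `A` red, `uP` = the u–P edges red,
`e` = the outside edges of the dropped piece `P` BLUE, far arms omitted — the big block is exactly the
cube minus its LEAKING points (`P` in the hull with its outside edges of the hull's colour), the red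
and blue edge sets are monotone functions of `(s, a, uP)` exchanged by the total flip, and on every
block of the census the conditioning `Q` is a lower set of this cube.  This file records in the kernel
that lowerness of `Q` is NOT enough for the inequality on the cube minus the leak: the lower set
`Q₁ = {a = false, uP = false}` (four points, one of them leaking) has, for the up-set `↑{arm, u}`,
red count 2 and blue count 1 (`bigBlock_lower_not_enough`).  So a proof of the big-block inequality
must use a property of the geometric `Q` beyond lowerness — the exact open item.
-/

namespace Summit.Ventures.PercRepro2

namespace BigBlock

/-- A point of the raw 4-cube: `(s, a, uP, e)`. -/
abbrev Pt4 := Bool × Bool × Bool × Bool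

/-- The atoms: `0` = the u-arm, `1` = `u`, `2` = the h-piece `A`, `3` = the dropped piece `P`. -/
abbrev Atom4 := Fin 4

/-- The red edge set: the red u-arm with `u`, `A` when red, `P` when red-attached to a red `u`. -/
def ER4 (p : Pt4) : Finset Atom4 :=
  (if p.1 then {0, 1} else ∅) ∪ (if p.2.1 then {2} else ∅) ∪ (if p.1 ∧ p.2.2.1 then {3} else ∅)

/-- The blue edge set: the red edge set of the flipped point. -/
def EB4 (p : Pt4) : Finset Atom4 := ER4 (!p.1, !p.2.1, !p.2.2.1, !p.2.2.2)

/-- The leaking points: `P` in the hull with its outside edges of the hull's colour. -/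
def leak4 (p : Pt4) : Bool :=
  (p.1 && p.2.2.1 && !p.2.2.2) || (!p.1 && !p.2.2.1 && p.2.2.2)

/-- The conditioning set of the witness: `a = false ∧ uP = false`. -/
def Q₁ : Finset Pt4 :=
  {(false, false, false, false), (false, false, false, true), (true, false, false, false),
    (true, false, false, true)}

/-- The up-set `↑{arm, u}`. -/
def 𝓔₁ : Finset (Finset Atom4) :=
  {{0, 1}, {0, 1, 2}, {0, 1, 3}, {0, 1, 2, 3}}

/-- `𝓔₁` is an up-set of atom sets. -/
theorem isUpper_𝓔₁ : ∀ F ∈ 𝓔₁, ∀ G : Finset Atom4, F ⊆ G → G ∈ 𝓔₁ := by decide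

/-- `Q₁` is a lower set of the 4-cube (product order on `Bool`). -/
theorem Q₁_lower : ∀ p ∈ Q₁, ∀ q : Pt4, q ≤ p → q ∈ Q₁ := by decide

/-- **Lowerness is not enough for the big block**: on `Q₁` minus the leaking points the red count for
`↑{arm, u}` is 2 and the blue count is 1. -/
theorem bigBlock_lower_not_enough :
    ((Q₁.filter fun p => leak4 p = false).filter fun p => EB4 p ∈ 𝓔₁).card <
      ((Q₁.filter fun p => leak4 p = false).filter fun p => ER4 p ∈ 𝓔₁).card := by
  decide

end BigBlock

end Summit.Ventures.PercRepro2
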